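import Summits.BirchSwinnertonDyer.BirchSwinnertonDyer.Theorems.ResidualThetaTransportAtTwoResidualSignedLambdaLowerCMAtTwoLocalBlockCountDloc
import Summits.BirchSwinnertonDyer.BirchSwinnertonDyer.Theorems.UniversalToricDescentInertiaH1Structure
import HarnessLib

/-!
# The LOCAL BLOCK of RSL_g's one-pair count at a RAMIFIED odd place: `H¹(ℚ_{∞,w̃}, A_ρ)[2^k]` is FINITE and `CharacterModule Dloc` is a finitely generated
# `ℤ₂`-module at EVERY `w ∤ 2` — no inertia hypothesis (FIN at the level primes `w ∣ M` of the S1⊕ text)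

Route `ResidualThetaTransportAtTwo` (RTT), crux RSL_g `ResidualSignedLambdaLowerCMAtTwo` (stmt-BirchSwinnertonDyer-22608); width seat
`prover-bsd-wall-tp2-p2x-w3` g16 (`--supports 22608 --as helper`, closes nothing). THEOREMS ONLY (no definition, no named fact, no instance, no notation,
no `sorry`). Seventh file of the local-block chain. The S1⊕ split text (LEAD rtt-p2 g18, bus 2026-08-29T05:23:34Z) asks for
`Module.Finite ℚ_[2] (ℚ_[2] ⊗[ℤ_[2]] PAway S κ ρ S₀)` with `PAway = Π (w ∈ S₀) (c : C w), CharacterModule (Dloc S κ ρ w)` ranging over ALL of `S₀` — including the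
LEVEL primes `w ∣ M`, where `ρ` may be RAMIFIED; p698653's `module_finite_characterModule_subgroupH1_cofree` covered only `ρ.IsUnramifiedAt w`. This file removes
that hypothesis, using the structure of the inertia group of an `ℓ`-adic field (`ℓ ≠ p`) that the route UTD already holds (tame `p`-generator, pro-prime-to-`p`
kernel, `#H¹(I_F, B) = #B^{I_F}` for finite `B`):

* §1 (abstract: `K` a number field, `κ` ANY `ℤ_p`-extension, `v ∤ p` not split completely in `κ`, `Hi = Gal(K̄_v/K_{∞,w}) = localSubgroup (ker κ) K_v`)
  `finite_subgroupH1_localSubgroup_of_finite`: **`H¹(Hi, B)` is finite for a FINITE discrete `p`-primary `Γ_{K_v}`-module `B`** with continuous orbits and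
  ARBITRARY inertia action — `res : H¹(Hi, B) ↪ H¹(I ∩ Hi, B)` (injectivity half of UTD's `resSubgroup_localSubgroup_bijective`, `Hi/I` pro-prime-to-`p`),
  inflation along `I_{K_v} ≅ I ∩ Hi` (`map_one_injective_of_surjective`), and `#H¹(I_{K_v}, B) = #B^{I_{K_v}}` (UTD's
  `natCard_continuousCohomology_one_absInertia_eq_natCard_invariants`); then `finite_torsionBy_subgroupH1_localSubgroup`: **`H¹(Hi, A)[p^k]` is finite** for a
  discrete `p`-primary `p`-divisible `A` with finite layers (it is the image of `H¹(Hi, A[p^k])`, p695381's `range_pushTorsion_eq_torsionBy`).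
* §2 (the carrier of record at `p = 2`) `finite_torsionBy_subgroupH1_cofree'`: **`Dloc[2^k]` finite at every `w ∤ 2` not split completely in `κ`**, for
  `Dloc = subgroupH1 (localSubgroup κ.kerSubgroup ℚ_w) (Cofree (ρ.toLocal w) F)` (`= OnePair.Dloc S κ ρ w` by `rfl`), NO `ρ.IsUnramifiedAt w`.
* §3, for ANY `ℤ₂`-module structure on `Dloc`: `module_finite_characterModule_subgroupH1_cofree'` (co-Nakayama, as p698653 §3) and
  **`module_finite_baseChange_characterModule_subgroupH1_cofree'`: `Module.Finite ℚ₂ (ℚ₂ ⊗_{ℤ₂} CharacterModule Dloc)`** — the FIN clause of S1⊕ per block,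
  at good AND level places.

BSD is not proved by any of this; RSL_g (22608) is not proved here.
References: [GreenbergVatsal2000] §2 Prop. (2.4) and proof (arXiv p. 22), p. 17; [GreenbergLNM1716] §3 Lemma 3.3; [SerreLocalFields1979] Ch. XIII §1 Prop. 1,
Ch. IV §2; [MilneADT2006] I §2 Lemma 2.9; [SerreGaloisCohomology1997] I §2.6 (b); [Greenberg2006] §3 A (proof of Prop. 3.2).
-/

set_option autoImplicit false
-- the Theorems namespace of this sub repeats the summit name by design (D-0017 nested layout)
set_option linter.dupNamespace false

noncomputable section

open scoped Classical TensorProduct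

namespace Summit.BirchSwinnertonDyer.BirchSwinnertonDyer.Theorems.ThetaTransport.LocalBlockCount

open NumberField IsDedekindDomain Field
open Literature.NumberTheory.EllipticCurves Literature.NumberTheory.GaloisRepresentations
  Literature.NumberTheory.GaloisRepresentations.IsNonarchimedeanLocalField Literature.NumberTheory.EllipticCurves.GreenbergSelmer
  IsDedekindDomain.HeightOneSpectrum ContinuousCohomology
  Summit.BirchSwinnertonDyer.BirchSwinnertonDyer.Theorems.UniversalToricDescentLocalH1Transfer
  Summit.BirchSwinnertonDyer.BirchSwinnertonDyer.Theorems.UniversalToricDescentLocalH1Count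
  Summit.BirchSwinnertonDyer.BirchSwinnertonDyer.Theorems.UniversalToricDescentInertiaH1Structure

/-! ## §1 Abstract: `H¹(Hi, B)` finite for finite `B`, and the layers `H¹(Hi, A)[p^k]` finite — ARBITRARY inertia action -/

section Abstract

variable {K : Type} [Field K] [NumberField K] {v : HeightOneSpectrum (𝓞 K)} {p : ℕ} [Fact p.Prime]
  (κ : ZpExtension K p)

/-- **`H¹(Hi, B)` is finite** (`Hi = Gal(K̄_v/K_{∞,w})`, `v ∤ p` not split completely in the `ℤ_p`-extension `κ`) for a FINITE discrete `p`-primary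
`Γ_{K_v}`-module `B` with continuous orbit maps and ARBITRARY inertia action: `H¹(Hi, B) ↪ H¹(I ∩ Hi, B)` (`Hi/I` is pro-prime-to-`p`), `≅ H¹(I_{K_v}, B)` by
inflation along `I_{K_v} ≅ I ∩ Hi`, and `#H¹(I_{K_v}, B) = #B^{I_{K_v}}` (tame `p`-generator, pro-prime-to-`p` kernel).
[cite: GreenbergVatsal2000, §2 p. 17 and Prop. (2.4) (proof, arXiv p. 22)] [cite: SerreLocalFields1979, Ch. XIII §1 Prop. 1] [cite: MilneADT2006, I §2 Lemma 2.9] -/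
theorem finite_subgroupH1_localSubgroup_of_finite (hpv : (p : 𝓞 K) ∉ v.asIdeal)
    (hns : ∃ σ : absoluteGaloisGroup (v.adicCompletion K), σ ∉ localSubgroup κ.kerSubgroup (v.adicCompletion K))
    {B : Type} [AddCommGroup B] [DistribMulAction (absoluteGaloisGroup (v.adicCompletion K)) B] [TopologicalSpace B] [DiscreteTopology B] [Finite B]
    (hB : ∀ b : B, ∃ k : ℕ, p ^ k • b = 0) (hcont : ∀ b : B, Continuous fun g : absoluteGaloisGroup (v.adicCompletion K) ↦ g • b) :
    Finite (subgroupH1 (localSubgroup κ.kerSubgroup (v.adicCompletion K)) B) := by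
  haveI : CharZero (v.adicCompletion K) := charZero_of_injective_algebraMap (algebraMap K (v.adicCompletion K)).injective
  haveI hIn : (absInertia (v.adicCompletion K)).Normal := absInertia_normal_holds (v.adicCompletion K)
  have hℓ := v.ringChar_residueField_adicCompletion_ne hpv
  -- (1) `res : H¹(Hi, B) → H¹(I ∩ Hi, B)` is injective
  have hbij := resSubgroup_localSubgroup_bijective κ hpv hns hB hcont (hIn := hIn)
  -- (2) inflation along `θ : I_{K_v} ≅ I ∩ Hi` is injective
  have hle : absInertia (v.adicCompletion K) ≤ localSubgroup κ.kerSubgroup (v.adicCompletion K) := absInertia_le_localSubgroup κ hpv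
  let θ : absInertia (v.adicCompletion K) →ₜ*
      (absInertia (v.adicCompletion K)).subgroupOf (localSubgroup κ.kerSubgroup (v.adicCompletion K)) :=
    { toFun := fun x ↦ ⟨⟨x.1, hle x.2⟩, Subgroup.mem_subgroupOf.mpr x.2⟩
      map_one' := rfl
      map_mul' := fun _ _ ↦ rfl
      continuous_toFun := (continuous_subtype_val.subtype_mk _).subtype_mk _ }
  have hθ : Function.Surjective θ := fun y ↦
    ⟨⟨((y : localSubgroup κ.kerSubgroup (v.adicCompletion K)) : absoluteGaloisGroup (v.adicCompletion K)), Subgroup.mem_subgroupOf.mp y.2⟩,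
      Subtype.ext (Subtype.ext rfl)⟩
  let X : TopRep ℤ ((absInertia (v.adicCompletion K)).subgroupOf (localSubgroup κ.kerSubgroup (v.adicCompletion K))) :=
    subgroupRep (discreteTopRep (localSubgroup κ.kerSubgroup (v.adicCompletion K)) B)
      ((absInertia (v.adicCompletion K)).subgroupOf (localSubgroup κ.kerSubgroup (v.adicCompletion K)))
  have hinj := map_one_injective_of_surjective X θ hθ
  -- (3) `#H¹(I_{K_v}, B) = #B^{I_{K_v}}`, in the `ContinuousRep` currency
  let ρB : ContinuousRep (absoluteGaloisGroup (v.adicCompletion K)) ℤ B :=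
    { toRepresentation := (discreteContRep (absoluteGaloisGroup (v.adicCompletion K)) B).toRepresentation
      continuous_smul := continuous_prod_of_discrete_right.mpr fun b ↦ hcont b }
  have heq : TopRep.res (θ : absInertia (v.adicCompletion K) →* (absInertia (v.adicCompletion K)).subgroupOf (localSubgroup κ.kerSubgroup (v.adicCompletion K))) X =
      (ρB.restrict (Literature.NumberTheory.GaloisRepresentations.subgroupIncl (absInertia (v.adicCompletion K)))).toTopRep := rfl
  have hcard := natCard_continuousCohomology_one_absInertia_eq_natCard_invariants (v.adicCompletion K) hℓ ρB hB
  haveI : Finite (continuousCohomology 1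
      ((ρB.restrict (Literature.NumberTheory.GaloisRepresentations.subgroupIncl (absInertia (v.adicCompletion K)))).toTopRep)) := by
    refine Nat.finite_of_card_ne_zero ?_
    rw [hcard]
    haveI : Nonempty {a : B // ∀ σ ∈ absInertia (v.adicCompletion K), ρB σ a = a} := ⟨⟨0, fun σ _ ↦ map_zero _⟩⟩
    exact Nat.card_pos.ne'
  haveI : Finite (continuousCohomology 1 (TopRep.res (θ : absInertia (v.adicCompletion K) →*
      (absInertia (v.adicCompletion K)).subgroupOf (localSubgroup κ.kerSubgroup (v.adicCompletion K))) X)) := by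
    rw [heq]; infer_instance
  haveI : Finite (continuousCohomology 1 X) := Finite.of_injective _ hinj
  exact Finite.of_injective (fun x : subgroupH1 (localSubgroup κ.kerSubgroup (v.adicCompletion K)) B ↦
    resSubgroup (discreteTopRep (localSubgroup κ.kerSubgroup (v.adicCompletion K)) B)
      ((absInertia (v.adicCompletion K)).subgroupOf (localSubgroup κ.kerSubgroup (v.adicCompletion K))) 1 x)
    (fun x₁ x₂ h ↦ hbij.1 (Subtype.ext h))

variable {A : Type} [AddCommGroup A] [DistribMulAction (absoluteGaloisGroup (v.adicCompletion K)) A] [TopologicalSpace A] [DiscreteTopology A]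

/-- **`H¹(Hi, A)[p^k]` is finite — ARBITRARY inertia action** — for a discrete `p`-primary `p`-divisible `Γ_{K_v}`-module `A` with finite layers and continuous
orbit maps, at `v ∤ p` not split completely in `κ`: it is the image of `H¹(Hi, A[p^k])` (`range_pushTorsion_eq_torsionBy`), finite by
`finite_subgroupH1_localSubgroup_of_finite`. (p698653's `finite_torsionBy_subgroupH1_of_frob` assumed trivial inertia action.)
[cite: GreenbergVatsal2000, §2 Prop. (2.4) and proof (arXiv p. 22)] -/
theorem finite_torsionBy_subgroupH1_localSubgroup (hpv : (p : 𝓞 K) ∉ v.asIdeal)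
    (hns : ∃ σ : absoluteGaloisGroup (v.adicCompletion K), σ ∉ localSubgroup κ.kerSubgroup (v.adicCompletion K))
    (hA : ∀ a : A, ∃ k : ℕ, p ^ k • a = 0) (hdiv : ∀ a : A, ∃ b : A, p • b = a)
    (hfin : ∀ k : ℕ, Finite (AddSubgroup.torsionBy A ((p ^ k : ℕ) : ℤ)))
    (hcont : ∀ a : A, Continuous fun g : absoluteGaloisGroup (v.adicCompletion K) ↦ g • a) (k : ℕ) :
    Finite (AddSubgroup.torsionBy (subgroupH1 (localSubgroup κ.kerSubgroup (v.adicCompletion K)) A) ((p ^ k : ℕ) : ℤ)) := by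
  haveI : Finite (AddSubgroup.torsionBy A ((p ^ k : ℕ) : ℤ)) := hfin k
  have hB : ∀ b : AddSubgroup.torsionBy A ((p ^ k : ℕ) : ℤ), ∃ k' : ℕ, p ^ k' • b = 0 := fun b ↦ by
    obtain ⟨k', hk'⟩ := hA b
    exact ⟨k', Subtype.ext (by rw [AddSubgroupClass.coe_nsmul, ZeroMemClass.coe_zero]; exact hk')⟩
  have hcontB : ∀ b : AddSubgroup.torsionBy A ((p ^ k : ℕ) : ℤ),
      Continuous fun g : absoluteGaloisGroup (v.adicCompletion K) ↦ g • b := fun b ↦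
    continuous_induced_rng.mpr (by simpa only [Function.comp_def, AddSubgroup.torsionBy.coe_smul] using hcont (b : A))
  haveI := finite_subgroupH1_localSubgroup_of_finite κ hpv hns hB hcontB
  rw [← range_pushTorsion_eq_torsionBy κ (p ^ k) (exists_pow_nsmul_eq_of_forall_exists hdiv k) hcont]
  exact (Set.finite_range _).to_subtype

end Abstract

/-! ## §2 The carrier of record at `p = 2`: `Dloc[2^k]` finite at every `w ∤ 2`, no `ρ.IsUnramifiedAt w` -/

section Carrier

variable (S : Set (PadicAlgCl 2)) [FiniteDimensional ℚ_[2] (padicCoeffField S)]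
  (ρ : FramedGaloisRep ℚ (padicCoeffIntegers S) 2) (κ : ZpExtension ℚ 2) {w : HeightOneSpectrum (𝓞 ℚ)}

/-- **FIN on the carrier of record, RAMIFIED OR NOT: `Dloc[2^k]` is finite** at every place `w ∤ 2` not split completely in `κ` (§1 with the cofree
hypotheses: `2`-primary, `2`-divisible, finite layers, continuous orbit maps). [cite: GreenbergVatsal2000, §2 Prop. (2.4)] -/
theorem finite_torsionBy_subgroupH1_cofree' (h2w : ((2 : ℕ) : 𝓞 ℚ) ∉ w.asIdeal)
    (hns : ∃ σ : absoluteGaloisGroup (w.adicCompletion ℚ), σ ∉ localSubgroup κ.kerSubgroup (w.adicCompletion ℚ)) (k : ℕ) :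
    Finite (AddSubgroup.torsionBy (subgroupH1 (localSubgroup κ.kerSubgroup (w.adicCompletion ℚ)) (Cofree (ρ.toLocal w) (padicCoeffField S))) ((2 ^ k : ℕ) : ℤ)) :=
  finite_torsionBy_subgroupH1_localSubgroup κ h2w hns (exists_pow_smul_cofree_eq_zero S (ρ.toLocal w)) (exists_two_nsmul_eq_cofree S ρ)
    (fun k ↦ Summit.BirchSwinnertonDyer.BirchSwinnertonDyer.Theorems.LambdaLowerBoundO.finite_torsionBy_cofree_pow S ρ k) (continuous_smul_cofree S ρ) k

end Carrier

/-! ## §3 S1⊕ packaging for ANY `ℤ₂`-module structure on `Dloc`, no `ρ.IsUnramifiedAt w` -/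

section Packaging

variable (S : Set (PadicAlgCl 2)) [FiniteDimensional ℚ_[2] (padicCoeffField S)]
  (ρ : FramedGaloisRep ℚ (padicCoeffIntegers S) 2) (κ : ZpExtension ℚ 2) {w : HeightOneSpectrum (𝓞 ℚ)}
  [Module ℤ_[2] (subgroupH1 (localSubgroup κ.kerSubgroup (w.adicCompletion ℚ)) (Cofree (ρ.toLocal w) (padicCoeffField S)))]

/-- **`CharacterModule Dloc` is a finitely generated `ℤ₂`-module at EVERY `w ∤ 2`** not split completely in `κ` (no `ρ.IsUnramifiedAt w`), for ANY `ℤ₂`-module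
structure on `Dloc`: classes are `2`-power torsion, `Dloc[2]` is finite (`finite_torsionBy_subgroupH1_cofree'`), `ℤ₂` is `(2)`-adically complete; co-Nakayama
`CharacterModule.module_finite_of_finite_torsionBySet`. [cite: Greenberg2006, §3 A (proof of Prop. 3.2)] [cite: GreenbergVatsal2000, §2 Prop. (2.4)] -/
theorem module_finite_characterModule_subgroupH1_cofree' (h2w : ((2 : ℕ) : 𝓞 ℚ) ∉ w.asIdeal)
    (hns : ∃ σ : absoluteGaloisGroup (w.adicCompletion ℚ), σ ∉ localSubgroup κ.kerSubgroup (w.adicCompletion ℚ)) :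
    Module.Finite ℤ_[2] (CharacterModule (subgroupH1 (localSubgroup κ.kerSubgroup (w.adicCompletion ℚ)) (Cofree (ρ.toLocal w) (padicCoeffField S)))) := by
  have hA : ∀ c : subgroupH1 (localSubgroup κ.kerSubgroup (w.adicCompletion ℚ)) (Cofree (ρ.toLocal w) (padicCoeffField S)), ∃ k : ℕ, 2 ^ k • c = 0 :=
    exists_pow_nsmul_eq_zero κ (exists_pow_smul_cofree_eq_zero S (ρ.toLocal w))
  haveI : IsPrecomplete (Ideal.span {(2 : ℤ_[2])}) ℤ_[2] := by
    rw [show (2 : ℤ_[2]) = ((2 : ℕ) : ℤ_[2]) by norm_cast, ← PadicInt.maximalIdeal_eq_span_p]; infer_instance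
  haveI := finite_torsionBy_subgroupH1_cofree' S ρ κ h2w hns 1
  haveI : Finite (Submodule.torsionBySet ℤ_[2] (subgroupH1 (localSubgroup κ.kerSubgroup (w.adicCompletion ℚ)) (Cofree (ρ.toLocal w) (padicCoeffField S)))
      ((Ideal.span {(2 : ℤ_[2])} : Ideal ℤ_[2]) : Set ℤ_[2])) := by
    refine Finite.of_injective (fun s ↦ (⟨s.1, AddSubgroup.torsionBy.nsmul_iff.mpr ?_⟩ :
      AddSubgroup.torsionBy (subgroupH1 (localSubgroup κ.kerSubgroup (w.adicCompletion ℚ)) (Cofree (ρ.toLocal w) (padicCoeffField S)))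
        ((2 ^ 1 : ℕ) : ℤ))) (fun s t h ↦ Subtype.ext ?_)
    · have h := (Submodule.mem_torsionBySet_iff _ _).mp s.2 ⟨2, Ideal.subset_span rfl⟩
      rw [pow_one, ← Nat.cast_smul_eq_nsmul ℤ_[2], Nat.cast_ofNat]
      exact h
    · exact congrArg (fun x : AddSubgroup.torsionBy (subgroupH1 (localSubgroup κ.kerSubgroup (w.adicCompletion ℚ))
        (Cofree (ρ.toLocal w) (padicCoeffField S))) ((2 ^ 1 : ℕ) : ℤ) ↦
          (x : subgroupH1 (localSubgroup κ.kerSubgroup (w.adicCompletion ℚ)) (Cofree (ρ.toLocal w) (padicCoeffField S)))) h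
  refine Literature.Algebra.Module.CharacterModule.module_finite_of_finite_torsionBySet (Ideal.span {(2 : ℤ_[2])}) ⟨{2}, by simp⟩ fun s ↦ ?_
  obtain ⟨k, hk⟩ := hA s
  refine ⟨k, fun r hr ↦ ?_⟩
  rw [Ideal.span_singleton_pow, Ideal.mem_span_singleton'] at hr
  obtain ⟨c, rfl⟩ := hr
  rw [mul_smul, show (2 : ℤ_[2]) ^ k = ((2 ^ k : ℕ) : ℤ_[2]) by norm_cast, Nat.cast_smul_eq_nsmul, hk, smul_zero]

/-- **FIN clause of S1⊕ per block, at EVERY `w ∤ 2` (good or level): `Module.Finite ℚ₂ (ℚ₂ ⊗_{ℤ₂} CharacterModule Dloc)`** for ANY `ℤ₂`-module structure on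
`Dloc` (base change of `module_finite_characterModule_subgroupH1_cofree'`). [cite: Greenberg2006, §3 A (proof of Prop. 3.2)] -/
theorem module_finite_baseChange_characterModule_subgroupH1_cofree' (h2w : ((2 : ℕ) : 𝓞 ℚ) ∉ w.asIdeal)
    (hns : ∃ σ : absoluteGaloisGroup (w.adicCompletion ℚ), σ ∉ localSubgroup κ.kerSubgroup (w.adicCompletion ℚ)) :
    Module.Finite ℚ_[2] (ℚ_[2] ⊗[ℤ_[2]] CharacterModule (subgroupH1 (localSubgroup κ.kerSubgroup (w.adicCompletion ℚ)) (Cofree (ρ.toLocal w) (padicCoeffField S)))) := by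
  haveI := module_finite_characterModule_subgroupH1_cofree' S ρ κ h2w hns
  infer_instance

end Packaging

end Summit.BirchSwinnertonDyer.BirchSwinnertonDyer.Theorems.ThetaTransport.LocalBlockCount

end
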